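import Literature.NumberTheory.LFunctions.ChebotarevDensityNumberField
import HarnessLib

/-!
# Dirichlet densities of sets of rational primes: from the strong notion, and back to `𝓞 ℚ`

Topic `Literature/NumberTheory/LFunctions`; namespace `Literature.NumberTheory.LFunctions`.
Everything in this file is PROVED (theorems only).  Two further bridges between the tree's
density notions (see `NumberFieldDirichletDensity.lean` for the overview), for sets of
**rational** primes:

* `hasDirichletDensity_of_hasPrimeLogAsymp` — the strong notion for a set `X ⊆ ℕ`
  (`Literature.NumberTheory.LFunctions.HasPrimeLogAsymp` of its indicator on the primes: `Σ_{p ∈ X} p^{-s} + c log (s-1)`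
  converges as `s → 1⁺`, `PrimeLogDensity.lean`) implies the limit notion
  `Literature.NumberTheory.LFunctions.HasDirichletDensity X c` (`Σ_{p ∈ X} p^{-s} / log (1/(s-1)) → c`);
* `NumberField.hasDirichletDensity_rat_of_natPrimesOf` — the converse of the tree's
  `hasDirichletDensity_natPrimesOf` (`ChebotarevDensityNumberField.lean`): if the set
  `natPrimesOf P` of rational primes below `P ⊆ {primes of 𝓞 ℚ}` has Dirichlet density `d`, then
  `P` has density `d` in Neukirch's sense (13.1) over `ℚ` (`NumberField.HasDirichletDensity ℚ P d`),
  and the equivalence `NumberField.hasDirichletDensity_rat_iff_natPrimesOf`.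

These are the last formal steps of the density-form crossing argument for Chebotarev's theorem
over `ℚ`: densities produced over auxiliary fields are transferred to `HasPrimeLogAsymp`
statements about rational primes (`PrimeLogDensity.lean`), squeezed in the limit notion
(`DirichletDensitySqueeze.lean`), and finally restated for the primes of `𝓞 ℚ`
(`Chebotarev.HasChebotarevDensities ℚ L`).

## References

* J. Neukirch, *Algebraic Number Theory*, Springer 1999, VII (13.1). [NeukirchANT1999]
* J.-P. Serre, *Cours d'arithmétique*, PUF 1970, VI §4.1.
-/

noncomputable section

open Filter IsDedekindDomain Rat.HeightOneSpectrum
open scoped NumberField Topology Classical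

namespace Literature.NumberTheory.LFunctions

/-- The prime sum of a set of rational primes is the prime series of its indicator:
`Σ_{p prime, p ∈ X} p^{-s} = primeSeries 1_X s`. [folklore] -/
theorem tsum_ite_prime_mem_eq_primeSeries (X : Set ℕ) (s : ℝ) :
    (∑' p : ℕ, if p.Prime ∧ p ∈ X then (p : ℝ) ^ (-s) else 0) =
      primeSeries (fun p ↦ X.indicator (fun _ ↦ (1 : ℝ)) p) s := by
  rw [primeSeries_def]
  set f : ℕ → ℝ := fun p ↦ if p.Prime ∧ p ∈ X then (p : ℝ) ^ (-s) else 0 with hf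
  have h1 : ∑' p : ℕ, f p = ∑' q : Nat.Primes, f q := by
    change ∑' p : ℕ, f p = ∑' q : (setOf Nat.Prime : Set ℕ), f q
    rw [tsum_subtype (setOf Nat.Prime) f]
    refine tsum_congr fun p ↦ ?_
    by_cases hp : p.Prime
    · rw [Set.indicator_of_mem (show p ∈ setOf Nat.Prime from hp)]
    · rw [Set.indicator_of_notMem (show p ∉ setOf Nat.Prime from hp), hf]
      simp only [hp, false_and, if_false]
  rw [h1]
  refine tsum_congr fun q ↦ ?_
  by_cases hq : (q : ℕ) ∈ X
  · rw [hf, Set.indicator_of_mem hq]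
    simp [q.2, hq]
  · rw [hf, Set.indicator_of_notMem hq]
    simp [hq]

/-- **Strong density of a set of rational primes implies its Dirichlet density**: if
`Σ_{p ∈ X} p^{-s} + c · log (s-1)` converges as `s → 1⁺` (`HasPrimeLogAsymp 1_X c`), then
`Σ_{p ∈ X} p^{-s} / log (1/(s-1)) → c` (`HasDirichletDensity X c`). [folklore] -/
theorem hasDirichletDensity_of_hasPrimeLogAsymp {X : Set ℕ} {c : ℝ}
    (h : HasPrimeLogAsymp (fun p ↦ X.indicator (fun _ ↦ (1 : ℝ)) p) c) :
    HasDirichletDensity X c := by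
  obtain ⟨L, hL⟩ := h
  rw [hasDirichletDensity_iff]
  have hℓ := PrimeSum.tendsto_log_one_div_sub_one
  -- `(P + c log (s-1)) / ℓ → 0`, and `c log (s-1) / ℓ = -c`
  have h1 : Tendsto (fun s : ℝ ↦ (primeSeries (fun p ↦ X.indicator (fun _ ↦ (1 : ℝ)) p) s +
      c * Real.log (s - 1)) / Real.log (1 / (s - 1))) (𝓝[>] (1 : ℝ)) (𝓝 0) :=
    hL.div_atTop hℓ
  have h2 := h1.add_const c
  rw [zero_add] at h2
  refine h2.congr' ?_
  filter_upwards [PrimeSum.eventually_log_pos] with s hlog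
  rw [tsum_ite_prime_mem_eq_primeSeries]
  have hM : Real.log (1 / (s - 1)) = -Real.log (s - 1) := by rw [one_div, Real.log_inv]
  rw [hM] at hlog ⊢
  have hne : Real.log (s - 1) ≠ 0 := by
    intro h0
    rw [h0, neg_zero] at hlog
    exact lt_irrefl _ hlog
  field_simp
  ring

namespace NumberField

/-- **From rational primes back to the primes of `𝓞 ℚ`**: if `natPrimesOf P` has Dirichlet
density `d` (`log (1/(s-1))` form), then `P ⊆ {primes of 𝓞 ℚ}` has density `d` in Neukirch's
sense (13.1) over `ℚ` (divide by the case `P = univ`, the tree's `PrimeSum.tendsto_univ_div_log`;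
converse of `hasDirichletDensity_natPrimesOf`). [cite: NeukirchANT1999, VII (13.1)] -/
theorem hasDirichletDensity_rat_of_natPrimesOf {P : Set (HeightOneSpectrum (𝓞 ℚ))} {d : ℝ}
    (h : Literature.NumberTheory.LFunctions.HasDirichletDensity (natPrimesOf P) d) :
    NumberField.HasDirichletDensity ℚ P d := by
  rw [Literature.NumberTheory.LFunctions.hasDirichletDensity_iff] at h
  rw [NumberField.hasDirichletDensity_iff]
  set FX : ℝ → ℝ := fun s ↦ ∑' p : ℕ, if p.Prime ∧ p ∈ natPrimesOf P then (p : ℝ) ^ (-s) else 0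
    with hFX
  set FU : ℝ → ℝ := fun s ↦
    ∑' p : ℕ, if p.Prime ∧ p ∈ (Set.univ : Set ℕ) then (p : ℝ) ^ (-s) else 0 with hFU
  have hnum : ∀ s : ℝ, (∑' v : HeightOneSpectrum (𝓞 ℚ),
      if v ∈ P then (Ideal.absNorm v.asIdeal : ℝ) ^ (-s) else 0) = FX s := fun s ↦
    tsum_heightOneSpectrum_eq_tsum_nat P s
  have hden : ∀ s : ℝ, (∑' v : HeightOneSpectrum (𝓞 ℚ), (Ideal.absNorm v.asIdeal : ℝ) ^ (-s)) =
      FU s := by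
    intro s
    have h1 := tsum_heightOneSpectrum_eq_tsum_nat Set.univ s
    simp only [Set.mem_univ, if_true] at h1
    rw [h1, hFU]
    refine tsum_congr fun p ↦ ?_
    by_cases hp : p.Prime
    · have : p ∈ natPrimesOf Set.univ := ⟨primesEquiv.symm ⟨p, hp⟩, Set.mem_univ _, by simp⟩
      simp [hp, this]
    · simp [hp]
  have hU : Tendsto (fun s : ℝ ↦ FU s / Real.log (1 / (s - 1))) (𝓝[>] (1 : ℝ)) (𝓝 1) :=
    PrimeSum.tendsto_univ_div_log
  have hX : Tendsto (fun s : ℝ ↦ FX s / Real.log (1 / (s - 1))) (𝓝[>] (1 : ℝ)) (𝓝 d) := h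
  have hdiv := hX.div hU one_ne_zero
  rw [div_one] at hdiv
  refine hdiv.congr' ?_
  filter_upwards [PrimeSum.eventually_log_pos] with s hlog
  rw [hnum, hden, Pi.div_apply, div_div_div_cancel_right₀ hlog.ne']

/-- Over `ℚ`, **Neukirch's Dirichlet density of `P` is the Dirichlet density of the set of
rational primes below `P`** (`hasDirichletDensity_natPrimesOf` and its converse).
[cite: NeukirchANT1999, VII (13.1)] -/
theorem hasDirichletDensity_rat_iff_natPrimesOf {P : Set (HeightOneSpectrum (𝓞 ℚ))} {d : ℝ} :
    NumberField.HasDirichletDensity ℚ P d ↔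
      Literature.NumberTheory.LFunctions.HasDirichletDensity (natPrimesOf P) d :=
  ⟨hasDirichletDensity_natPrimesOf, hasDirichletDensity_rat_of_natPrimesOf⟩

end NumberField

end Literature.NumberTheory.LFunctions
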